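import Summits.Schanuel.Schanuel.Theorems.ZilberEacMonicCurvePolyFibresAll
import Mathlib.Algebra.Polynomial.SpecificDegree
import Mathlib.RingTheory.Polynomial.Eisenstein.Criterion
import HarnessLib

/-!
# Arbitrary base branches, LXI (b): EXAMPLES — two elliptic curves that are neither cyclic covers
# of the `x₀`-line nor Fermat curves: `x₁³ + x₁ + x₀² = 0` (row-degree criterion, no direction
# hypothesis) and `x₁³ + x₀²x₁ + x₀ = 0` (explicit direction)

HONEST FRAMING.  Cell `pub-schanuel` (Zilber's Exponential-Algebraic Closedness, case ladder;
host summit Schanuel), seat 2, gen 31.  Instances of file LXI: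
* `F = x₁³ + x₁ + x₀²` (the elliptic curve `x₀² = -x₁³ - x₁` lying on its side; irreducible by
  the cubic criterion — a root `a(x₀)` would have `3 deg a = 2`): rows of degrees `2, 0, 0`, weights
  `(k, M) = (3, 2)`, `3 ∤ 4`: **`unprojectedDensityQuestion_sideElliptic_polyFibre`** — for EVERY
  `R` nonzero somewhere on the curve, case ∧ dense; coordinate fibres `y₀ = x₀`, `y₀ = x₁`.
* `F = x₁³ + x₀²x₁ + x₀` (a smooth plane cubic; Eisenstein at `x₀`): rows of degrees `1, 2, 0`,
  weights `(1, 1)`, edge polynomial `t³ + t`, root `θ = i`, direction `z = 2πi`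
  (`Re(i·2πi) = -2π`): **`unprojectedDensityQuestion_cubicEisenstein_polyFibre`**.
Decided instances of an OPEN question (Mantova–Masser, PLMS 2024 §1 p. 5); EC(3,2) OPEN; NOT
Schanuel's conjecture (neither used nor implied); EAC ⇏ SC.
-/

noncomputable section

open Filter Topology Set Complex Polynomial
open Literature.NumberTheory.Transcendental Literature.ModelTheory.Zilber
open Literature.ModelTheory.ExponentialFields

set_option linter.dupNamespace false

namespace Summit.Schanuel.Schanuel.Theorems

/-! ## Example 1. `x₁³ + x₁ + x₀² = 0`, weights `(3, 2)`: no direction hypothesis -/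

section SideElliptic

/-- The curve `x₁³ + x₁ + x₀² = 0` as an element of `ℂ[x₀][x₁]`. -/
private theorem sideElliptic_eval (x y : ℂ) :
    ((X ^ 3 + X + Polynomial.C (X ^ 2 : ℂ[X]) : ℂ[X][X]).map (Polynomial.evalRingHom x)).eval y =
      y ^ 3 + y + x ^ 2 := by
  simp

/-- Auxiliary computation for the example (`sideElliptic_natDegree`). [folklore] -/
private theorem sideElliptic_natDegree :
    (X ^ 3 + X + Polynomial.C (X ^ 2 : ℂ[X]) : ℂ[X][X]).natDegree = 3 := by
  compute_degree!

/-- Auxiliary computation for the example (`sideElliptic_coeff`). [folklore] -/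
private theorem sideElliptic_coeff (j : ℕ) :
    (X ^ 3 + X + Polynomial.C (X ^ 2 : ℂ[X]) : ℂ[X][X]).coeff j =
      if j = 3 then 1 else if j = 1 then 1 else if j = 0 then X ^ 2 else 0 := by
  simp only [Polynomial.coeff_add, Polynomial.coeff_X_pow, Polynomial.coeff_X, Polynomial.coeff_C]
  rcases j with _ | _ | _ | _ | j <;> simp

/-- Auxiliary computation for the example (`sideElliptic_monic`). [folklore] -/
private theorem sideElliptic_monic : (X ^ 3 + X + Polynomial.C (X ^ 2 : ℂ[X]) : ℂ[X][X]).Monic := by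
  rw [Polynomial.Monic, Polynomial.leadingCoeff, sideElliptic_natDegree, sideElliptic_coeff]
  simp

/-- `x₁³ + x₁ + x₀²` is irreducible in `ℂ[x₀][x₁]`: a root `a ∈ ℂ[x₀]` would satisfy
`a³ + a = -x₀²`, impossible by degrees. [folklore] -/
private theorem sideElliptic_irreducible :
    Irreducible (X ^ 3 + X + Polynomial.C (X ^ 2 : ℂ[X]) : ℂ[X][X]) := by
  rw [sideElliptic_monic.irreducible_iff_roots_eq_zero_of_degree_le_three
    (by rw [sideElliptic_natDegree]; norm_num) (by rw [sideElliptic_natDegree]),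
    Multiset.eq_zero_iff_forall_notMem]
  intro a ha
  rw [Polynomial.mem_roots sideElliptic_monic.ne_zero, Polynomial.IsRoot] at ha
  simp only [Polynomial.eval_add, Polynomial.eval_pow, Polynomial.eval_X, Polynomial.eval_C] at ha
  have h : a ^ 3 + a = -X ^ 2 := by linear_combination ha
  have hdeg := congrArg Polynomial.natDegree h
  rw [Polynomial.natDegree_neg, Polynomial.natDegree_X_pow] at hdeg
  by_cases ha0 : a.natDegree = 0
  · rw [Polynomial.eq_C_of_natDegree_eq_zero ha0, ← Polynomial.C_pow, ← Polynomial.C_add,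
      Polynomial.natDegree_C] at hdeg
    exact absurd hdeg (by norm_num)
  · have hlt : a.natDegree < (a ^ 3).natDegree := by
      rw [Polynomial.natDegree_pow]; omega
    rw [Polynomial.natDegree_add_eq_left_of_natDegree_lt hlt, Polynomial.natDegree_pow] at hdeg
    omega

/-- **`{x₁³ + x₁ + x₀² = 0, y₀ = R(x₀, x₁)}`: case ∧ dense for every `R` nonzero somewhere on
the curve** (weights `(3, 2)`, `3 ∤ 4`: the row-degree criterion of file LXI).
[cite: MantovaMasser2023, §1 Further remarks, p. 5 (the question, open in general)] (new) -/
theorem unprojectedDensityQuestion_sideElliptic_polyFibre (R : MvPolynomial (Fin 2) ℂ)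
    (hR : ∃ x y : ℂ, y ^ 3 + y + x ^ 2 = 0 ∧ MvPolynomial.eval ![x, y] R ≠ 0) :
    MMCaseDimPiOneFree {w : Fin 2 ⊕ Fin 2 → ℂ |
        w (Sum.inl 1) ^ 3 + w (Sum.inl 1) + w (Sum.inl 0) ^ 2 = 0 ∧
        w (Sum.inr 0) = MvPolynomial.eval ![w (Sum.inl 0), w (Sum.inl 1)] R} ∧
      UnprojectedDense {w : Fin 2 ⊕ Fin 2 → ℂ |
        w (Sum.inl 1) ^ 3 + w (Sum.inl 1) + w (Sum.inl 0) ^ 2 = 0 ∧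
        w (Sum.inr 0) = MvPolynomial.eval ![w (Sum.inl 0), w (Sum.inl 1)] R} := by
  have hset : {w : Fin 2 ⊕ Fin 2 → ℂ |
      w (Sum.inl 1) ^ 3 + w (Sum.inl 1) + w (Sum.inl 0) ^ 2 = 0 ∧
      w (Sum.inr 0) = MvPolynomial.eval ![w (Sum.inl 0), w (Sum.inl 1)] R} =
      {w : Fin 2 ⊕ Fin 2 → ℂ |
        ((X ^ 3 + X + Polynomial.C (X ^ 2 : ℂ[X]) : ℂ[X][X]).map
          (Polynomial.evalRingHom (w (Sum.inl 0)))).eval (w (Sum.inl 1)) = 0 ∧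
        w (Sum.inr 0) = MvPolynomial.eval ![w (Sum.inl 0), w (Sum.inl 1)] R} := by
    ext w; simp only [Set.mem_setOf_eq, sideElliptic_eval]
  rw [hset]
  refine unprojectedDensityQuestion_monicCurve_polyFibre_of_steepestEdge_not_dvd _ sideElliptic_monic
    sideElliptic_irreducible (by rw [sideElliptic_natDegree]; norm_num) (k := 3) (M := 2) (by norm_num)
    ?_ ?_ (by decide) R ?_
  · intro j hj
    rw [sideElliptic_natDegree] at hj ⊢
    rw [sideElliptic_coeff]
    interval_cases j <;> simp
  · refine ⟨0, by rw [sideElliptic_natDegree]; norm_num, ?_, ?_⟩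
    · rw [sideElliptic_coeff]; simp
    · rw [sideElliptic_coeff, sideElliptic_natDegree]; simp
  · obtain ⟨x, y, hxy, hne⟩ := hR
    exact ⟨x, y, by rw [sideElliptic_eval]; exact hxy, hne⟩

/-- **`{x₁³ + x₁ + x₀² = 0, y₀ = x₀}`: case ∧ dense.** [cite: MantovaMasser2023, §1 Further
remarks, p. 5 (the question, open in general)] (new) -/
theorem unprojectedDensityQuestion_sideElliptic_fibre_x₀ :
    MMCaseDimPiOneFree {w : Fin 2 ⊕ Fin 2 → ℂ |
        w (Sum.inl 1) ^ 3 + w (Sum.inl 1) + w (Sum.inl 0) ^ 2 = 0 ∧ w (Sum.inr 0) = w (Sum.inl 0)} ∧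
      UnprojectedDense {w : Fin 2 ⊕ Fin 2 → ℂ |
        w (Sum.inl 1) ^ 3 + w (Sum.inl 1) + w (Sum.inl 0) ^ 2 = 0 ∧ w (Sum.inr 0) = w (Sum.inl 0)} := by
  have h := unprojectedDensityQuestion_sideElliptic_polyFibre (MvPolynomial.X 0)
    ⟨(Real.sqrt 2 : ℂ), -1, by
      have h2 : ((Real.sqrt 2 : ℂ)) ^ 2 = 2 := by
        rw [← Complex.ofReal_pow, Real.sq_sqrt (by norm_num : (0 : ℝ) ≤ 2)]; norm_num
      rw [h2]; norm_num, by
      simp only [MvPolynomial.eval_X, Matrix.cons_val_zero, ne_eq, Complex.ofReal_eq_zero]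
      exact Real.sqrt_ne_zero'.2 (by norm_num)⟩
  simpa only [MvPolynomial.eval_X, Matrix.cons_val_zero] using h

/-- **`{x₁³ + x₁ + x₀² = 0, y₀ = x₁}`: case ∧ dense.** [cite: MantovaMasser2023, §1 Further
remarks, p. 5 (the question, open in general)] (new) -/
theorem unprojectedDensityQuestion_sideElliptic_fibre_x₁ :
    MMCaseDimPiOneFree {w : Fin 2 ⊕ Fin 2 → ℂ |
        w (Sum.inl 1) ^ 3 + w (Sum.inl 1) + w (Sum.inl 0) ^ 2 = 0 ∧ w (Sum.inr 0) = w (Sum.inl 1)} ∧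
      UnprojectedDense {w : Fin 2 ⊕ Fin 2 → ℂ |
        w (Sum.inl 1) ^ 3 + w (Sum.inl 1) + w (Sum.inl 0) ^ 2 = 0 ∧ w (Sum.inr 0) = w (Sum.inl 1)} := by
  have h := unprojectedDensityQuestion_sideElliptic_polyFibre (MvPolynomial.X 1)
    ⟨(Real.sqrt 2 : ℂ), -1, by
      have h2 : ((Real.sqrt 2 : ℂ)) ^ 2 = 2 := by
        rw [← Complex.ofReal_pow, Real.sq_sqrt (by norm_num : (0 : ℝ) ≤ 2)]; norm_num
      rw [h2]; norm_num, by
      simp only [MvPolynomial.eval_X, Matrix.cons_val_one, Matrix.cons_val_zero, ne_eq]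
      norm_num⟩
  simpa only [MvPolynomial.eval_X, Matrix.cons_val_one, Matrix.cons_val_zero] using h

end SideElliptic

/-! ## Example 2. `x₁³ + x₀²x₁ + x₀ = 0`, weights `(1, 1)`, direction `θ = i`, `z = 2πi` -/

section CubicEisenstein

/-- Auxiliary computation for the example (`cubicEisenstein_eval`). [folklore] -/
private theorem cubicEisenstein_eval (x y : ℂ) :
    ((X ^ 3 + Polynomial.C (X ^ 2 : ℂ[X]) * X + Polynomial.C (X : ℂ[X]) : ℂ[X][X]).map
        (Polynomial.evalRingHom x)).eval y = y ^ 3 + x ^ 2 * y + x := by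
  simp

/-- Auxiliary computation for the example (`cubicEisenstein_natDegree`). [folklore] -/
private theorem cubicEisenstein_natDegree :
    (X ^ 3 + Polynomial.C (X ^ 2 : ℂ[X]) * X + Polynomial.C (X : ℂ[X]) : ℂ[X][X]).natDegree = 3 := by
  compute_degree!

/-- Auxiliary computation for the example (`cubicEisenstein_coeff`). [folklore] -/
private theorem cubicEisenstein_coeff (j : ℕ) :
    (X ^ 3 + Polynomial.C (X ^ 2 : ℂ[X]) * X + Polynomial.C (X : ℂ[X]) : ℂ[X][X]).coeff j =
      if j = 3 then 1 else if j = 1 then X ^ 2 else if j = 0 then X else 0 := by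
  simp only [Polynomial.coeff_add, Polynomial.coeff_X_pow, Polynomial.coeff_C_mul, Polynomial.coeff_X,
    Polynomial.coeff_C]
  rcases j with _ | _ | _ | _ | j <;> simp

/-- Auxiliary computation for the example (`cubicEisenstein_monic`). [folklore] -/
private theorem cubicEisenstein_monic :
    (X ^ 3 + Polynomial.C (X ^ 2 : ℂ[X]) * X + Polynomial.C (X : ℂ[X]) : ℂ[X][X]).Monic := by
  rw [Polynomial.Monic, Polynomial.leadingCoeff, cubicEisenstein_natDegree, cubicEisenstein_coeff]
  simp

/-- `x₁³ + x₀²x₁ + x₀` is irreducible in `ℂ[x₀][x₁]` (Eisenstein at the prime `x₀`). [folklore] -/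
private theorem cubicEisenstein_irreducible :
    Irreducible (X ^ 3 + Polynomial.C (X ^ 2 : ℂ[X]) * X + Polynomial.C (X : ℂ[X]) : ℂ[X][X]) := by
  set F : ℂ[X][X] := X ^ 3 + Polynomial.C (X ^ 2 : ℂ[X]) * X + Polynomial.C (X : ℂ[X]) with hF
  have hP : (Ideal.span {(X : ℂ[X])}).IsPrime :=
    (Ideal.span_singleton_prime Polynomial.X_ne_zero).2 Polynomial.prime_X
  have hdeg : F.degree = 3 := by
    rw [Polynomial.degree_eq_natDegree cubicEisenstein_monic.ne_zero, cubicEisenstein_natDegree]; rfl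
  refine Polynomial.irreducible_of_eisenstein_criterion hP ?_ ?_ ?_ ?_ cubicEisenstein_monic.isPrimitive
  · rw [cubicEisenstein_monic.leadingCoeff, Ideal.mem_span_singleton]
    intro h
    have := Polynomial.natDegree_le_of_dvd h one_ne_zero
    rw [Polynomial.natDegree_X, Polynomial.natDegree_one] at this
    exact Nat.not_succ_le_zero 0 this
  · intro n hn
    rw [hdeg] at hn
    have hn3 : n < 3 := by exact_mod_cast hn
    rw [cubicEisenstein_coeff, Ideal.mem_span_singleton]
    interval_cases n <;> simp
  · rw [hdeg]; norm_num
  · rw [cubicEisenstein_coeff, Ideal.span_singleton_pow, Ideal.mem_span_singleton]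
    simp only [show ¬ (0 : ℕ) = 3 by norm_num, show ¬ (0 : ℕ) = 1 by norm_num, if_false, if_true]
    intro h
    have := Polynomial.natDegree_le_of_dvd h Polynomial.X_ne_zero
    rw [Polynomial.natDegree_pow, Polynomial.natDegree_X] at this
    omega

/-- **`{x₁³ + x₀²x₁ + x₀ = 0, y₀ = R(x₀, x₁)}`: case ∧ dense for every `R` nonzero somewhere
on the curve** (weights `(1, 1)`: edge polynomial `t³ + t`, root `i`, direction `z = 2πi` with
`Re(i·(2πi)) = -2π ≠ 0`). [cite: MantovaMasser2023, §1 Further remarks, p. 5 (the question, open in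
general)] (new) -/
theorem unprojectedDensityQuestion_cubicEisenstein_polyFibre (R : MvPolynomial (Fin 2) ℂ)
    (hR : ∃ x y : ℂ, y ^ 3 + x ^ 2 * y + x = 0 ∧ MvPolynomial.eval ![x, y] R ≠ 0) :
    MMCaseDimPiOneFree {w : Fin 2 ⊕ Fin 2 → ℂ |
        w (Sum.inl 1) ^ 3 + w (Sum.inl 0) ^ 2 * w (Sum.inl 1) + w (Sum.inl 0) = 0 ∧
        w (Sum.inr 0) = MvPolynomial.eval ![w (Sum.inl 0), w (Sum.inl 1)] R} ∧
      UnprojectedDense {w : Fin 2 ⊕ Fin 2 → ℂ |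
        w (Sum.inl 1) ^ 3 + w (Sum.inl 0) ^ 2 * w (Sum.inl 1) + w (Sum.inl 0) = 0 ∧
        w (Sum.inr 0) = MvPolynomial.eval ![w (Sum.inl 0), w (Sum.inl 1)] R} := by
  have hset : {w : Fin 2 ⊕ Fin 2 → ℂ |
      w (Sum.inl 1) ^ 3 + w (Sum.inl 0) ^ 2 * w (Sum.inl 1) + w (Sum.inl 0) = 0 ∧
      w (Sum.inr 0) = MvPolynomial.eval ![w (Sum.inl 0), w (Sum.inl 1)] R} =
      {w : Fin 2 ⊕ Fin 2 → ℂ |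
        ((X ^ 3 + Polynomial.C (X ^ 2 : ℂ[X]) * X + Polynomial.C (X : ℂ[X]) : ℂ[X][X]).map
          (Polynomial.evalRingHom (w (Sum.inl 0)))).eval (w (Sum.inl 1)) = 0 ∧
        w (Sum.inr 0) = MvPolynomial.eval ![w (Sum.inl 0), w (Sum.inl 1)] R} := by
    ext w; simp only [Set.mem_setOf_eq, cubicEisenstein_eval]
  rw [hset]
  refine unprojectedDensityQuestion_monicCurve_polyFibre_of_edgeRoot _ cubicEisenstein_monic
    cubicEisenstein_irreducible (by rw [cubicEisenstein_natDegree]; norm_num) (k := 1) (M := 1) le_rfl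
    le_rfl
    ?_ (E := X ^ 3 + X) ?_ (θ := I) ?_ ?_ R ?_
  · intro j hj
    rw [cubicEisenstein_natDegree] at hj ⊢
    rw [cubicEisenstein_coeff]
    interval_cases j <;> simp
  · intro j
    rw [cubicEisenstein_coeff, cubicEisenstein_natDegree]
    simp only [Polynomial.coeff_add, Polynomial.coeff_X_pow, Polynomial.coeff_X]
    rcases j with _ | _ | _ | _ | j <;> simp
  · simp only [Polynomial.IsRoot, Polynomial.eval_add, Polynomial.eval_pow, Polynomial.eval_X]
    rw [pow_succ, Complex.I_sq]; ring
  · refine ⟨2 * Real.pi * I, by rw [pow_one], ?_⟩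
    rw [pow_one, show I * (2 * Real.pi * I) = ((-(2 * Real.pi) : ℝ) : ℂ) by
      rw [mul_comm, mul_assoc, Complex.I_mul_I]; push_cast; ring, Complex.ofReal_re]
    have := Real.pi_pos
    intro h; linarith
  · obtain ⟨x, y, hxy, hne⟩ := hR
    exact ⟨x, y, by rw [cubicEisenstein_eval]; exact hxy, hne⟩

end CubicEisenstein

end Summit.Schanuel.Schanuel.Theorems

end
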